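import Summits.QuantumFields.QCD.Theorems.NestedDissectionSeaRobustYangMillsRGStubFormatBallClusteringFalseAux2
import Summits.QuantumFields.QCD.Theorems.NestedDissectionSeaRobustYangMillsRGStubFormatBallClusteringFalseAux3
import Summits.QuantumFields.QCD.Theorems.NestedDissectionSeaRobustYangMillsRGStubFormatBallClusteringFalseAux4
import Summits.QuantumFields.QCD.Theorems.NestedDissectionSeaRobustYangMillsRGStubWilsonAnalyticNorm
import Literature.MathematicalPhysics.QuantumFieldTheory.QuasiLocalGaugePerturbationWilson
import HarnessLib

/-!
# Stub `stub_formatBallClustering_false` of line `birth`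
(crux `Summit.QuantumFields.QCD.Theses.NestedDissectionSea.RobustYangMillsRG`, item stmt-QuantumFields-17812,
route route-QuantumFields-NestedDissectionSea; shared verbatim with `HeavyThresholdYMBridge`)

## Summary

The realisability-free transfer target `FormatBallClustering` of idea `af-funnel` (uniform slab
clustering for EVERY normalised SIGNED coercive-format density on the block torus, no fine lattice,
no blocking map) is FALSE. Witness (format constants `ε = r = B₀ = κ = c₀ = cA = 1`):

* `A = wilson` (coercive with equality, volume-uniform analytic norm by `stub_wilsonAnalyticNorm`
  and real norm by the tree's `normLE_wilson`; its activity-carrying polymers are plaquette supports,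
  so the range clause holds), `W = 0`;
* the SIGNED rough functional `F(Z, V) = ∏_{y ∈ Z ∩ T} φ(V(y,1))` on the sparse shift-free set `T`
  of slab sites `(0, 2k, 0, 0)`, `φ : SU(3) → [-1, 1]` the sign function of part III (`m₁ < m₂`,
  `0 ≤ m₃ ≤ m₁`): measurable, `F(∅) = 1`, `|F| ≤ 1 ≤ e^{|Z|}`, exactly local and exactly
  multiplicative over separated (hence disjoint) regions (part IV).

At `t = 0`, `h = 2`, `G₁ = G₂ = G := F(LF V, V)` (bounded by `1`, measurable, supported in the slab
of thickness `2`) the conclusion reads `|I(m₃)/I(m₁) - (I(m₂)/I(m₁))²| ≤ C`, where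
`I(m) = ∫ e^{-βe S_W} m^{#(T ∩ LF V)}` by tail-site gauge averaging (part II). But `I(m₃) ≤ I(m₁)`
while `I(m₂) ≥ (1 + (m₂/m₁ - 1) δ #T) I(m₁)` with `δ = e^{-576 βe} m₁ Haar(rough) > 0` independent of
the volume (part II with the finite-energy input of part IV and the rough-plaquette criterion of
part III); choosing `M = 2n₀ + 3` with `(m₂/m₁ - 1) δ n₀ ≥ |C| + 1` (so `#T ≥ n₀`) gives
`I(m₂)/I(m₁) ≥ |C| + 2`, contradicting the bound. Role in the line: Stub 1 (`stub_slabStateBound`)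
cannot be discharged from the format alone — only realisability (or a positivity repair of the
crux) excludes the extensive-sign members.
-/

noncomputable section

namespace Summit.QuantumFields.QCD.Cruxes.RobustYangMillsRG.Birth

open scoped BigOperators Topology Manifold Classical MeasureTheory ProbabilityTheory Matrix InnerProductSpace ComplexConjugate ContinuousMap
open Filter Set Function TopologicalSpace MeasureTheory
open Literature.MathematicalPhysics.QuantumLattice Literature.MathematicalPhysics.AQFT
  Literature.MathematicalPhysics.QuantumFieldTheory
open Summit.QuantumFields.QCD.Theorems.RobustYangMillsRG.Negative (SU3)

/-! ### The transfer target and its refutation -/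

set_option quotPrecheck false in
/-- Verbatim copy of `Summit.QuantumFields.QCD.Cruxes.RobustYangMillsRG.Ideator2.FormatBallClustering`
(crux workfile `Sketch_r1_k2.lean`, not importable here; identical to the line skeleton's
`Birth.FormatBallClustering`): the realisability-free transfer target C⁺ of idea `af-funnel`. It is
rendered as a LOCAL NOTATION for the verbatim term rather than as a `def`, because only registered
obligations may define propositions under `Theorems/` (an inline `def … : Prop` is relocated to
`Literature/` by the gate as a cited fact, which this FALSE proposition is not); the theorem below is
therefore stated against the skeleton's definition unfolded once, to which it applies by `rfl`-conversion. [folklore] -/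
local notation "FormatBallClustering" => (
  let G := ↥(Matrix.specialUnitaryGroup (Fin 3) ℂ)
  let ρ : G →* Matrix (Fin 3) (Fin 3) ℂ := fundamentalRep (Fin 3)
  ∀ ε r B₀ κ c₀ cA A₀ : ℝ, 0 < ε → 0 < r → 0 < B₀ → 0 < κ → 0 < c₀ → 0 < cA → 0 < A₀ →
  ∃ β₀ : ℝ, 0 < β₀ ∧ ∀ β₁ : ℝ, β₀ ≤ β₁ →
  ∃ Δ : ℝ, 0 < Δ ∧ ∀ h : ℕ, ∃ C : ℝ, ∀ (M : ℕ) [NeZero M],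
  let μ : Measure (GaugeConfig 4 M G) := Measure.pi fun _ => haarProbability G
  let LF : GaugeConfig 4 M G → Finset (Site 4 M) := fun V =>
    Finset.univ.filter fun y => ∃ i j : Fin 4, ε < 3 - (ρ (plaquetteHolonomy V y i j)).trace.re
  ∀ (βe : ℝ) (A W : QuasiLocalGaugePerturbation 4 M G 1)
    (F : Finset (Site 4 M) → GaugeConfig 4 M G → ℝ),
  β₀ ≤ βe → βe ≤ β₁ →
  A.HasAnalyticNormLE ρ (smallFieldDomain ρ 1 r ε) κ A₀ → A.NormLE κ A₀ →
  (∀ X ∈ polymers 1, (∃ V, A.act X V ≠ 0) →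
    ∀ y ∈ X, ∀ y' ∈ X, ∀ i, (y i - y' i).val ≤ X.card ∨ (y' i - y i).val ≤ X.card) →
  (∀ V, cA * wilsonAction ρ V ≤ A.total V - A.total fun _ => 1) →
  W.HasAnalyticNormLE ρ (smallFieldDomain ρ 1 r ε) κ B₀ → W.NormLE κ B₀ →
  (∀ X ∈ polymers 1, (∃ V, W.act X V ≠ 0) →
    ∀ y ∈ X, ∀ y' ∈ X, ∀ i, (y i - y' i).val ≤ X.card ∨ (y' i - y i).val ≤ X.card) →
  (∀ Z, Measurable (F Z)) → (∀ V, F ∅ V = 1) → (∀ Z V, |F Z V| ≤ Real.exp (c₀ * Z.card)) →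
  (∀ Z (n : ℕ) V V', (∀ e, (∃ y ∈ Z, ∀ i, (e.1 i - y i).val ≤ n ∨ (y i - e.1 i).val ≤ n) →
      V e = V' e) → |F Z V - F Z V'| ≤ Real.exp (c₀ * Z.card + κ * (4 - n))) →
  (∀ Z₁ Z₂ (n : ℕ), (∀ y ∈ Z₁, ∀ y' ∈ Z₂, ∃ i, n < (y i - y' i).val ∧ n < (y' i - y i).val) →
      ∀ V, |F (Z₁ ∪ Z₂) V - F Z₁ V * F Z₂ V| ≤ Real.exp (c₀ * (Z₁.card + Z₂.card) + κ * (4 - n))) →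
  let dens : GaugeConfig 4 M G → ℝ := fun V =>
    Real.exp (-(βe * A.total V) - W.total V) * F (LF V) V
  let E : (GaugeConfig 4 M G → ℝ) → ℝ := fun G₀ => (∫ V, G₀ V * dens V ∂μ) / ∫ V, dens V ∂μ
  (0 < ∫ V, dens V ∂μ) →
  ∀ (t : ℕ) (G₁ G₂ : GaugeConfig 4 M G → ℝ) (C₁ C₂ : ℝ), 2 * t ≤ M →
  Measurable G₁ → Measurable G₂ → (∀ V, |G₁ V| ≤ C₁) → (∀ V, |G₂ V| ≤ C₂) →
  DependsOn G₁ {e | (e.1 0).val < h} → DependsOn G₂ {e | (e.1 0).val < h} →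
  |E (fun V => G₁ V * G₂ (torusConfigShift (Pi.single 0 (t : ZMod M)) V))
    - E G₁ * E (fun V => G₂ (torusConfigShift (Pi.single 0 (t : ZMod M)) V))|
    ≤ C * C₁ * C₂ * Real.exp (-(Δ * t)))

namespace SignedFormat

/-- **The Gibbs moments of the sign observable** for the witness data (`A = wilson`, `W = 0`,
`F(Z,V) = ∏_{y ∈ Z ∩ T} φ(V(y,1))`, `T` shift-free in direction `1`, `LF` the format's rough region
at `ε = 1`): `∫ G^k · dens = ∫ e^{-β S_W} (∫ φ^{k+1})^{#(T ∩ LF V)}` — the witness instance of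
tail-site gauge averaging (gauge invariance and measurability of the rough region and of the Gibbs
factor). [folklore] -/
theorem integral_obs_pow_mul_dens {M : ℕ} [NeZero M] (T : Finset (Site 4 M))
    (hT : ∀ y ∈ T, ∀ y' ∈ T, y'.shift 1 ≠ y) {β : ℝ} (hβ : 0 ≤ β) {φ : SU3 → ℝ}
    (hφ : Measurable φ) (hφ1 : ∀ u, |φ u| ≤ 1) (k : ℕ) :
    ∫ V, (∏ y ∈ T, (if y ∈ (Finset.univ.filter fun x => ∃ i j : Fin 4,
              (1 : ℝ) < 3 - (fundamentalRep (Fin 3) (plaquetteHolonomy V x i j)).trace.re)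
            then φ (V (y, 1)) else 1)) ^ k *
        (Real.exp (-(β * (QuasiLocalGaugePerturbation.wilson (fundamentalRep (Fin 3))
              (continuous_fundamentalRep (Fin 3)) 1 : QuasiLocalGaugePerturbation 4 M SU3 1).total V) -
            (0 : QuasiLocalGaugePerturbation 4 M SU3 1).total V) *
          ∏ y ∈ T, (if y ∈ (Finset.univ.filter fun x => ∃ i j : Fin 4,
                (1 : ℝ) < 3 - (fundamentalRep (Fin 3) (plaquetteHolonomy V x i j)).trace.re)
              then φ (V (y, 1)) else 1))
        ∂(Measure.pi fun _ : Edge 4 M => haarProbability SU3) =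
      ∫ V, Real.exp (-(β * wilsonAction (fundamentalRep (Fin 3)) V)) *
          ∏ y ∈ T, (if y ∈ (Finset.univ.filter fun x => ∃ i j : Fin 4,
                (1 : ℝ) < 3 - (fundamentalRep (Fin 3) (plaquetteHolonomy V x i j)).trace.re)
              then ∫ u, φ u ^ (k + 1) ∂haarProbability SU3 else 1)
        ∂Measure.pi fun _ : Edge 4 M => haarProbability SU3 := by
  set LF : GaugeConfig 4 M SU3 → Finset (Site 4 M) := fun V => Finset.univ.filter fun x => ∃ i j : Fin 4,
    (1 : ℝ) < 3 - (fundamentalRep (Fin 3) (plaquetteHolonomy V x i j)).trace.re with hLF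
  simp only [QuasiLocalGaugePerturbation.total_wilson, QuasiLocalGaugePerturbation.total_zero,
    Pi.zero_apply, sub_zero]
  have h1 : ∀ V : GaugeConfig 4 M SU3,
      (∏ y ∈ T, (if y ∈ LF V then φ (V (y, 1)) else 1)) ^ k *
        (Real.exp (-(β * wilsonAction (fundamentalRep (Fin 3)) V)) * ∏ y ∈ T, (if y ∈ LF V then φ (V (y, 1)) else 1)) =
      Real.exp (-(β * wilsonAction (fundamentalRep (Fin 3)) V)) *
        ∏ y ∈ T, (if y ∈ LF V then φ (V (y, 1)) ^ (k + 1) else 1) := fun V => by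
    rw [← prod_ite_mem_apply_pow, pow_succ]; ring
  rw [integral_congr_ae (ae_of_all _ h1)]
  refine integral_weight_mul_prod_apply_eq (G := SU3) hT (fun g V => ?_) (fun y => ?_) (measurable_gibbs β)
    (fun V => by rw [abs_of_pos (Real.exp_pos _)]; exact gibbs_le_one hβ V)
    (fun g V => by rw [wilsonAction_gaugeTransform]) (hφ.pow_const _) fun u => by
      rw [abs_pow]; exact pow_le_one₀ (abs_nonneg _) (hφ1 u)
  · exact roughFilter_gaugeTransform g V
  · exact measurableSet_mem_roughFilter y

end SignedFormat

/-- **Stub N3 — the realisability-free signed transfer target is false** (`¬ FormatBallClustering`).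
Witness (format constants `ε = r = B₀ = κ = c₀ = cA = 1`): `A = wilson` (coercive with equality,
volume-uniform analytic and real norms — `stub_wilsonAnalyticNorm`, tree `normLE_wilson`), `W = 0`,
and the SIGNED rough functional `F(Z, V) = ∏_{y ∈ Z ∩ T} φ(V(y,1))` on the sparse shift-free set `T`
of slab sites `(0, 2k, 0, 0)`, `φ : SU(3) → [-1, 1]` the sign function (`m₁ < m₂`, `0 ≤ m₃ ≤ m₁`).
All format clauses hold exactly (locality and factorisation with zero error). At `t = 0`, `h = 2`,
`G₁ = G₂ = G := F(LF V, V)` the conclusion reads `|I(m₃)/I(m₁) - (I(m₂)/I(m₁))²| ≤ C` with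
`I(m) = ∫ e^{-βe S_W} m^{#(T ∩ LF V)}` (tail-site gauge averaging: the links `V(y,1)`, `y ∈ T`, are
i.i.d. Haar given the roughness pattern), where `I(m₃)/I(m₁) ≤ 1` while
`I(m₂)/I(m₁) ≥ 1 + (m₂/m₁ - 1) δ #T` with `δ = e^{-576 βe} m₁ Haar(rough) > 0` INDEPENDENT OF THE
VOLUME (finite-energy bound: right-multiplying one link by a Haar element makes its site rough with
probability `Haar(rough)` at Gibbs cost `≤ e^{576 βe}`); the volume `M = 2n₀ + 3` with
`(m₂/m₁ - 1) δ n₀ ≥ |C| + 1` contradicts the bound. Role in the line: Stub 1 (`stub_slabStateBound`)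
cannot be discharged from the format alone — only realisability (or a positivity repair of the crux)
can exclude the extensive-sign members. [folklore] -/
theorem stub_formatBallClustering_false : ¬ FormatBallClustering := by
  intro hFBC
  -- the sign function and the rough set of group elements
  obtain ⟨φ, hφm, hφ1, hm1pos, hm1le, hm12, hm3nn, hm31⟩ := SignedFormat.exists_signFunction
  obtain ⟨-, hrough, -⟩ := stub_su3SignSet
  obtain ⟨hS₁m, hq₁⟩ := hrough 1 (by norm_num)
  -- the volume-uniform principal-norm bounds
  obtain ⟨A₀', hA₀', hAan⟩ := stub_wilsonAnalyticNorm 1 1 1 one_pos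
  obtain ⟨Ar, hAr⟩ : ∃ Ar : ℝ, ∀ (M : ℕ) [NeZero M],
      (QuasiLocalGaugePerturbation.wilson (fundamentalRep (Fin 3)) (continuous_fundamentalRep (Fin 3)) 1 :
        QuasiLocalGaugePerturbation 4 M SU3 1).NormLE 1 Ar :=
    ⟨_, fun M _ => QuasiLocalGaugePerturbation.normLE_wilson _ _ fundamentalRep_mem_unitaryGroup
      zero_le_one one_pos⟩
  have hA₀ : 0 < max A₀' Ar := lt_max_of_lt_left hA₀'
  -- instantiate the transfer target: `β₀`, then `Δ` (at `β₁ = β₀`), then `C` (at `h = 2`)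
  obtain ⟨β₀, hβ₀, H⟩ := hFBC 1 1 1 1 1 1 (max A₀' Ar) one_pos one_pos one_pos one_pos one_pos
    one_pos hA₀
  obtain ⟨Δ, -, H⟩ := H β₀ le_rfl
  obtain ⟨C, H⟩ := H 2
  -- the volume-independent growth rate `(ratio - 1) δ`
  have hratio1 : 1 < (∫ u, φ u ^ 2 ∂haarProbability SU3) / ∫ u, φ u ∂haarProbability SU3 :=
    (one_lt_div hm1pos).2 hm12
  have hδ0 : 0 < Real.exp (-(β₀ * 576)) * (∫ u, φ u ∂haarProbability SU3) *
      (haarProbability SU3).real {g : SU3 | (1 : ℝ) < 3 - (fundamentalRep (Fin 3) g).trace.re} :=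
    mul_pos (mul_pos (Real.exp_pos _) hm1pos) hq₁
  have hgap := mul_pos (sub_pos.2 hratio1) hδ0
  -- the volume
  obtain ⟨n₀, hn₀⟩ := exists_nat_ge ((|C| + 1) /
    ((((∫ u, φ u ^ 2 ∂haarProbability SU3) / ∫ u, φ u ∂haarProbability SU3) - 1) *
      (Real.exp (-(β₀ * 576)) * (∫ u, φ u ∂haarProbability SU3) *
        (haarProbability SU3).real {g : SU3 | (1 : ℝ) < 3 - (fundamentalRep (Fin 3) g).trace.re})))
  obtain ⟨M, hM⟩ : ∃ M : ℕ, M = 2 * n₀ + 3 := ⟨_, rfl⟩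
  haveI : NeZero M := ⟨by omega⟩
  have hM3 : 3 ≤ M := by omega
  -- the sign sites `T`
  obtain ⟨T, hT⟩ : ∃ T : Finset (Site 4 M), T = Finset.univ.filter fun y : Site 4 M =>
      y 0 = 0 ∧ y 2 = 0 ∧ y 3 = 0 ∧ Even (y 1).val ∧ (y 1).val + 2 ≤ M := ⟨_, rfl⟩
  have hTmem : ∀ y ∈ T, y 0 = 0 ∧ y 2 = 0 ∧ y 3 = 0 ∧ Even (y 1).val ∧ (y 1).val + 2 ≤ M := by
    rw [hT]; exact fun y hy => (Finset.mem_filter.1 hy).2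
  have hTsf : ∀ y ∈ T, ∀ y' ∈ T, ∀ i, y'.shift i ≠ y := fun y hy y' hy' i =>
    SignedFormat.shift_ne_of_signSite hM3 (hTmem y hy) (hTmem y' hy') i
  have hTcard : (n₀ : ℝ) ≤ (T.card : ℝ) := by
    rw [hT]; exact_mod_cast SignedFormat.le_card_filter_signSite (M := M) (by omega)
  -- the weight and the rough region feeding the toolkit
  have hΨm := SignedFormat.measurable_gibbs (M := M) β₀
  have hΨ0 : ∀ V : GaugeConfig 4 M SU3, 0 < Real.exp (-(β₀ * wilsonAction (fundamentalRep (Fin 3)) V)) :=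
    fun V => Real.exp_pos _
  have hΨ1 := SignedFormat.gibbs_le_one (M := M) hβ₀.le
  have hLFm := SignedFormat.measurableSet_mem_roughFilter (M := M)
  -- the three Gibbs moments `∫ G^k dens = I(m_{k+1})`
  have hI1 := SignedFormat.integral_obs_pow_mul_dens T (fun y hy y' hy' => hTsf y hy y' hy' 1) hβ₀.le hφm hφ1 0
  have hI2 := SignedFormat.integral_obs_pow_mul_dens T (fun y hy y' hy' => hTsf y hy y' hy' 1) hβ₀.le hφm hφ1 1
  have hI3 := SignedFormat.integral_obs_pow_mul_dens T (fun y hy y' hy' => hTsf y hy y' hy' 1) hβ₀.le hφm hφ1 2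
  simp only [pow_zero, one_mul, zero_add, pow_one] at hI1 hI2
  simp only [pow_two] at hI3
  have hI1pos := SignedFormat.integral_weight_mul_prod_pos (T := T)
    (LF := fun V : GaugeConfig 4 M SU3 => Finset.univ.filter fun x => ∃ i j : Fin 4,
      (1 : ℝ) < 3 - (fundamentalRep (Fin 3) (plaquetteHolonomy V x i j)).trace.re)
    hΨm hΨ0 hΨ1 hLFm hm1pos
  -- the instance of the conclusion at `t = 0`, `G₁ = G₂ = G`, `C₁ = C₂ = 1`
  have key := H M β₀
    (QuasiLocalGaugePerturbation.wilson (fundamentalRep (Fin 3)) (continuous_fundamentalRep (Fin 3)) 1) 0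
    (fun Z V => ∏ y ∈ T, (if y ∈ Z then φ (V (y, 1)) else 1)) le_rfl le_rfl
    ((hAan M).mono _ (le_max_left _ _)) ((hAr M).mono (le_max_right _ _))
    (fun X _ hX => SignedFormat.wilson_range X hX) SignedFormat.wilson_coercive
    (QuasiLocalGaugePerturbation.hasAnalyticNormLE_zero _ _ zero_le_one)
    (QuasiLocalGaugePerturbation.normLE_zero zero_le_one)
    (fun X _ hX => by obtain ⟨V, hV⟩ := hX; exact absurd (QuasiLocalGaugePerturbation.zero_act X V) hV)
    (SignedFormat.measurable_signF T hφm) (SignedFormat.signF_empty T φ)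
    (fun Z V => (SignedFormat.abs_signF_le_one T hφ1 Z V).trans
      (Real.one_le_exp (mul_nonneg zero_le_one (Nat.cast_nonneg _))))
    (fun Z n V V' h => by
      rw [SignedFormat.signF_congr_local T φ h, sub_self, abs_zero]; exact (Real.exp_pos _).le)
    (fun Z₁ Z₂ n h V => by
      rw [SignedFormat.signF_union T φ h, sub_self, abs_zero]; exact (Real.exp_pos _).le)
    (lt_of_lt_of_eq hI1pos hI1.symm)
    0 (fun V => ∏ y ∈ T, (if y ∈ (Finset.univ.filter fun x => ∃ i j : Fin 4,
        (1 : ℝ) < 3 - (fundamentalRep (Fin 3) (plaquetteHolonomy V x i j)).trace.re) then φ (V (y, 1)) else 1))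
      (fun V => ∏ y ∈ T, (if y ∈ (Finset.univ.filter fun x => ∃ i j : Fin 4,
        (1 : ℝ) < 3 - (fundamentalRep (Fin 3) (plaquetteHolonomy V x i j)).trace.re) then φ (V (y, 1)) else 1))
      1 1 (by omega)
    (SignedFormat.measurable_prod_ite_mem_apply hLFm hφm) (SignedFormat.measurable_prod_ite_mem_apply hLFm hφm)
    (SignedFormat.abs_prod_ite_mem_apply_le_one hφ1) (SignedFormat.abs_prod_ite_mem_apply_le_one hφ1)
    (fun V V' hVV' => Finset.prod_congr rfl fun y hy => by
      obtain ⟨hr, hv⟩ := SignedFormat.roughFilter_congr_slab (hTmem y hy).1 fun e he => hVV' e he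
      simp only [hr, hv])
    (fun V V' hVV' => Finset.prod_congr rfl fun y hy => by
      obtain ⟨hr, hv⟩ := SignedFormat.roughFilter_congr_slab (hTmem y hy).1 fun e he => hVV' e he
      simp only [hr, hv])
  -- `t = 0`: the shift is the identity and the rate factor is one; insert the moments
  simp only [Nat.cast_zero, Pi.single_zero, SignedFormat.torusConfigShift_zero, mul_zero, neg_zero,
    Real.exp_zero, mul_one] at key
  rw [hI1, hI2, hI3] at key
  -- abbreviations
  set m₁ : ℝ := ∫ u, φ u ∂haarProbability SU3 with hm₁
  set m₂ : ℝ := ∫ u, φ u ^ 2 ∂haarProbability SU3 with hm₂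
  set m₃ : ℝ := ∫ u, φ u ^ 3 ∂haarProbability SU3 with hm₃
  set ratio : ℝ := m₂ / m₁ with hratio
  set δ : ℝ := Real.exp (-(β₀ * 576)) * m₁ *
    (haarProbability SU3).real {g : SU3 | (1 : ℝ) < 3 - (fundamentalRep (Fin 3) g).trace.re} with hδ
  set I₁ : ℝ := ∫ V, Real.exp (-(β₀ * wilsonAction (fundamentalRep (Fin 3)) V)) *
    ∏ y ∈ T, (if y ∈ (Finset.univ.filter fun x => ∃ i j : Fin 4,
        (1 : ℝ) < 3 - (fundamentalRep (Fin 3) (plaquetteHolonomy V x i j)).trace.re) then m₁ else 1)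
    ∂Measure.pi fun _ : Edge 4 M => haarProbability SU3 with hI₁
  set I₂ : ℝ := ∫ V, Real.exp (-(β₀ * wilsonAction (fundamentalRep (Fin 3)) V)) *
    ∏ y ∈ T, (if y ∈ (Finset.univ.filter fun x => ∃ i j : Fin 4,
        (1 : ℝ) < 3 - (fundamentalRep (Fin 3) (plaquetteHolonomy V x i j)).trace.re) then m₂ else 1)
    ∂Measure.pi fun _ : Edge 4 M => haarProbability SU3 with hI₂
  set I₃ : ℝ := ∫ V, Real.exp (-(β₀ * wilsonAction (fundamentalRep (Fin 3)) V)) *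
    ∏ y ∈ T, (if y ∈ (Finset.univ.filter fun x => ∃ i j : Fin 4,
        (1 : ℝ) < 3 - (fundamentalRep (Fin 3) (plaquetteHolonomy V x i j)).trace.re) then m₃ else 1)
    ∂Measure.pi fun _ : Edge 4 M => haarProbability SU3 with hI₃
  -- `I₃ ≤ I₁` and the growth bound `I₂ ≥ (1 + (ratio - 1) δ #T) I₁`
  have hI31 : I₃ ≤ I₁ := SignedFormat.integral_weight_mul_prod_mono hΨm hΨ0 hΨ1 hLFm hm3nn hm31
  have hm₂' : m₁ * ratio = m₂ := by rw [hratio]; field_simp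
  have hgrowth : (1 + (ratio - 1) * δ * T.card) * I₁ ≤ I₂ := by
    have h := SignedFormat.growth_integral_weight_mul_prod (T := T)
      (LF := fun V : GaugeConfig 4 M SU3 => Finset.univ.filter fun x => ∃ i j : Fin 4,
        (1 : ℝ) < 3 - (fundamentalRep (Fin 3) (plaquetteHolonomy V x i j)).trace.re)
      hΨm hΨ0 hΨ1 (Real.exp_pos (-(β₀ * 576))).le
      (fun y _ V a => SignedFormat.gibbs_update_ge hβ₀.le (y, 2) V a) hLFm hm1pos hm1le
      (fun y hy y' hy' hne V a => SignedFormat.mem_roughFilter_update_of_ne hM3 (hTmem y hy) (hTmem y' hy') hne 2 V a)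
      hS₁m (fun y hy V a h => SignedFormat.mem_roughFilter_update_of_mem hM3 (hTmem y hy) V a h) hratio1.le
    rw [hm₂'] at h
    exact h
  -- `I₂ / I₁ ≥ |C| + 2`
  have hn₀' : |C| + 1 ≤ (ratio - 1) * δ * n₀ := by
    have := (div_le_iff₀ hgap).1 hn₀
    linarith
  have hI21 : (|C| + 2) * I₁ ≤ I₂ := by
    refine le_trans (mul_le_mul_of_nonneg_right ?_ hI1pos.le) hgrowth
    have : (ratio - 1) * δ * n₀ ≤ (ratio - 1) * δ * T.card := mul_le_mul_of_nonneg_left hTcard hgap.le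
    linarith
  -- the contradiction
  have hx : |C| + 2 ≤ I₂ / I₁ := (le_div_iff₀ hI1pos).2 hI21
  have hz : I₃ / I₁ ≤ 1 := (div_le_one hI1pos).2 hI31
  have hkey : I₂ / I₁ * (I₂ / I₁) - I₃ / I₁ ≤ C := by
    have := neg_abs_le (I₃ / I₁ - I₂ / I₁ * (I₂ / I₁))
    linarith
  have hsq : (|C| + 2) * (|C| + 2) ≤ I₂ / I₁ * (I₂ / I₁) :=
    mul_le_mul hx hx (by positivity) (by linarith [abs_nonneg C])
  nlinarith [abs_nonneg C, le_abs_self C]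

end Summit.QuantumFields.QCD.Cruxes.RobustYangMillsRG.Birth
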